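import Literature.AlgebraicGeometry.Frobenioids.ArchimedeanNonIsotropicFactorizations
import HarnessLib

/-!
# Frobenioids II, Proposition 3.5 (ii): a non-isotropic object of `C` over an RC-anchor of `D` is an anchor of `C`

Mochizuki, *The geometry of Frobenioids II: poly-Frobenioids*, Kyushu J. Math. **62** (2008) 401–460,
§3, Proposition 3.5 (ii), proof, kurims text p. 35 ll. 8–27 [cite: MochizukiFrdII2008, Prop 3.5 (ii) p.34]:
"we conclude that it suffices to prove that `C` is an anchor of `F`, i.e., that the collection of
isomorphism classes of `^C F` arising from irreducible morphisms `C → C′` is finite. … the finiteness … then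
follows immediately from the fact that `C_D` is an anchor of `D[ℂ]` (respectively, from Lemma 3.2, (v)) …
(respectively, … from Lemma 3.2, (iii), (vii))."

PROOF-ONLY companion, part 3 (abc-iut cell, layer L1, node `FrdII:Prop3.5(ii)`, sub-row P35-L05
`NonIsotropicOverAnchorIsAnchor`; seat abc-iut-w4-d092). **`NonIso.isAnchor_of_nonIsotropic`**: in
`C = C₀ ×_{D₀} D` over ANY `π : D → D₀`, an object `X` whose angular region is not isotropic and whose
`D`-component `X_D` is an anchor of the complex part `D[ℂ]` (for `D → D₀ → ArchBase`) is an anchor of `C`.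
Every irreducible `f : X → Y` is, up to isomorphism under `X`, (F) the Frobenius-type arrow `powHom X d` of
its degree `d ≠ 1`, with `d` bounded by Lemma 3.2 (v) (larger powers factor through the isotropic hull);
(H) for linear `f` with invertible `f_D`: a region enlargement, which irreducibility forces to be THE
isotropic hull (`extHom_irreducible_imp`; Lemma 3.2 (vi)(b)); (P) for linear `f` with non-invertible `f_D`:
the push-forward of `X` along `f_D`, an irreducible arrow of `D[ℂ]` out of the anchor `X_D` — finitely many
classes in each kind. No total epimorphicity or connectedness of `D` is used. No definitions; no statement
of the paper is strengthened; nothing here bears on [IUTchIII] Cor. 3.12.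
-/

namespace Literature.AlgebraicGeometry.Frobenioids

open CategoryTheory Set
open scoped Pointwise

noncomputable section

universe v u

namespace ArchFrd

variable {D : Type u} [Category.{v} D] (π : D ⥤ D0)

namespace NonIso

/-- In a full subcategory, an arrow whose underlying arrow is an isomorphism is an isomorphism. [folklore] -/
private theorem isIso_of_isIso_hom'' {T : Type u} [Category.{v} T] {P : ObjectProperty T}
    {A B : P.FullSubcategory} (f : A ⟶ B) [IsIso f.hom] : IsIso f :=
  ⟨⟨ObjectProperty.homMk (inv f.hom), ObjectProperty.hom_ext _ (IsIso.hom_inv_id f.hom),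
    ObjectProperty.hom_ext _ (IsIso.inv_hom_id f.hom)⟩⟩

/-- **Pull-back-type arrows out of a non-isotropic object have complex targets**: if `c · A_X = A_Y|_{Base φ}`
and `A_X` is not isotropic then `Y` is complex (a real `Y` has isotropic region, and so would `X`).
[cite: MochizukiFrdII2008, Prop 3.5 (ii) p.34] -/
theorem isComplex_of_full {X Y : C π} (φ : X ⟶ Y) (hX : ¬ X.fst.region.IsIsotropic)
    (hfull : C0.scalar φ.fst • X.fst.region.carrier = C0.pullRegion Y.fst (C0.Base φ.fst)) :
    (π.obj Y.snd).IsComplex := by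
  rcases D0.isReal_or_isComplex (π.obj Y.snd) with h | h
  · exfalso
    have hYb : Y.fst.base = π.obj Y.snd := D0.eq_of_isIso Y.iso.hom
    have hiso : Y.fst.region.IsIsotropic := C0.isNaivelyIsotropic_of_isRealObj (hYb.trans h)
    have hpull : C0.pullRegion Y.fst (C0.Base φ.fst) = Y.fst.region.carrier := by
      unfold C0.pullRegion D0.Hom.act
      rw [C0.image_galAct_of_isIsotropic hiso]
    have hdir : unitPart ℂ (C0.scalar φ.fst) • X.fst.region.dir = univ := by
      have h1 := X.fst.region.image_unitPart_smul_carrier_pow (C0.scalar φ.fst) 0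
      rw [zero_add, pow_one, pow_one, hfull, hpull, Y.fst.region.image_unitPart_carrier] at h1
      rw [← h1]; exact hiso
    apply hX
    change X.fst.region.dir = univ
    rw [← inv_smul_smul (unitPart ℂ (C0.scalar φ.fst)) X.fst.region.dir, hdir, Set.smul_set_univ]
  · exact h

/-- **The `D`-component of an irreducible pull-back-type arrow between complex objects is an irreducible
arrow of `D[ℂ]`** (factorisations of `φ_D` through complex objects lift through push-forwards).
[cite: MochizukiFrdII2008, Prop 3.5 (ii) p.34] -/
theorem irreducible_snd {X Y : C π} (φ : X ⟶ Y) (hirr : IsIrreducibleHom φ) (hd : C0.degFr φ.fst = 1)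
    (hfull : C0.scalar φ.fst • X.fst.region.carrier = C0.pullRegion Y.fst (C0.Base φ.fst))
    (hcX : RC.complexObjects (baseRC π) X.snd) (hcY : RC.complexObjects (baseRC π) Y.snd) :
    IsIrreducibleHom
      (ObjectProperty.homMk φ.snd : (⟨X.snd, hcX⟩ : RC.ComplexPart (baseRC π)) ⟶ ⟨Y.snd, hcY⟩) := by
  have hY : (π.obj Y.snd).IsComplex := (D0.complexObjects_comp_iff π Y.snd).mp hcY
  refine ⟨fun hi => hirr.1 ?_, fun Z β α h => ?_⟩
  · haveI := hi
    haveI : IsIso ((RC.complexObjects (baseRC π)).ι.map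
        (ObjectProperty.homMk φ.snd : (⟨X.snd, hcX⟩ : RC.ComplexPart (baseRC π)) ⟶ ⟨Y.snd, hcY⟩)) :=
      inferInstance
    haveI : IsIso φ.snd := this
    have hYb : Y.fst.base = D0.complex := (D0.eq_of_isIso Y.iso.hom).trans hY
    haveI : IsIso (C0.Base φ.fst) := QuotientLift.isIso_of_target_eq_complex _ hYb
    haveI : IsIso φ.fst := C0.isIso_of φ.fst hd hfull
    exact CFP.isIso_of_isIso_fst_snd φ
  · have h' : β.hom ≫ α.hom = φ.snd := congrArg (fun k => k.hom) h
    have hZ : (π.obj Z.obj).IsComplex := (D0.complexObjects_comp_iff π Z.obj).mp Z.property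
    obtain ⟨ψ, hfac, hψ⟩ := fac_push π φ β.hom α.hom hZ h'
    rcases hirr.2 _ _ hfac with hi | hi
    · left
      haveI := hi
      haveI : IsIso α.hom := by rw [← hψ]; exact CFP.isIso_snd ψ
      exact isIso_of_isIso_hom'' α
    · right
      haveI : IsIso β.hom := (isIso_pushHom_iff π X β.hom hZ).mp hi
      exact isIso_of_isIso_hom'' β

/-- The push-forward class map `^{X_D} D[ℂ] → ^X C` on isomorphism classes of objects under `X_D` resp. `X`.
[cite: MochizukiFrdII2008, Prop 3.5 (ii) p.34] -/
theorem exists_pushClassMap (X : C π) (hc : RC.complexObjects (baseRC π) X.snd) :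
    ∃ G : Quotient (isIsomorphicSetoid (Under (⟨X.snd, hc⟩ : RC.ComplexPart (baseRC π)))) →
        Quotient (isIsomorphicSetoid (Under X)),
      ∀ g : Under (⟨X.snd, hc⟩ : RC.ComplexPart (baseRC π)),
        G (Quotient.mk _ g) = Quotient.mk _ (Under.mk (pushHom π X g.hom.hom
          ((D0.complexObjects_comp_iff π g.right.obj).mp g.right.property))) := by
  refine ⟨Quotient.map' (fun g : Under (⟨X.snd, hc⟩ : RC.ComplexPart (baseRC π)) =>
    Under.mk (pushHom π X g.hom.hom ((D0.complexObjects_comp_iff π g.right.obj).mp g.right.property)))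
      ?_, fun g => rfl⟩
  rintro g g' ⟨i⟩
  exact push_under_iso π X g.hom.hom g'.hom.hom _ _
    ((RC.complexObjects (baseRC π)).ι.mapIso ((Under.forget _).mapIso i))
    (congrArg (fun k => k.hom) (Under.w i.hom))

/-- **A non-isotropic object of `C` lying over an anchor of `D[ℂ]` is an anchor of `C`** (the core of the proof
of Prop. 3.5 (ii), p. 35: "it suffices to prove that `C` is an anchor of `F`"), for `C = C₀ ×_{D₀} D` over
any `π : D → D₀`. [cite: MochizukiFrdII2008, Prop 3.5 (ii) p.34] -/
theorem isAnchor_of_nonIsotropic (X : C π) (hX : ¬ X.fst.region.IsIsotropic)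
    (hc : RC.complexObjects (baseRC π) X.snd)
    (hA : IsAnchor (⟨X.snd, hc⟩ : RC.ComplexPart (baseRC π))) : IsAnchor X := by
  obtain ⟨N, hN⟩ := AngularRegion.exists_pow_dir_eq_univ X.fst.region
  obtain ⟨G, hG⟩ := exists_pushClassMap π X hc
  -- the three finite families of classes
  let SF : Set (Quotient (isIsomorphicSetoid (Under X))) :=
    (fun n : ℕ => Quotient.mk _ (Under.mk (powHom π X n.succPNat))) '' Iio N
  let SH : Set (Quotient (isIsomorphicSetoid (Under X))) :=
    {Quotient.mk _ (Under.mk (extHom π X (AngularRegion.isotropicOfTip X.fst.region.tip)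
      (subset_univ _) le_rfl))}
  let SP : Set (Quotient (isIsomorphicSetoid (Under X))) :=
    G '' {y | ∃ g : Under (⟨X.snd, hc⟩ : RC.ComplexPart (baseRC π)),
      IsIrreducibleHom g.hom ∧ Quotient.mk _ g = y}
  have hfin : (SF ∪ (SH ∪ SP)).Finite :=
    ((finite_Iio N).image _).union ((finite_singleton _).union (hA.image G))
  refine hfin.subset ?_
  rintro x ⟨f, hf, rfl⟩
  by_cases hd : C0.degFr f.hom.fst = 1
  · by_cases hs : IsIso f.hom.snd
    · -- (H) a linear arrow over an isomorphism of `D`: the isotropic hull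
      refine Or.inr (Or.inl ?_)
      obtain ⟨T₀, hT, ht, j, hfac, hj⟩ := fac_ext π f.hom hd
      haveI := hj hs
      have hirr' : IsIrreducibleHom (extHom π X T₀ hT ht) := by
        have e : extHom π X T₀ hT ht = f.hom ≫ inv j := by
          rw [← cancel_mono j, Category.assoc, IsIso.inv_hom_id, Category.comp_id]; exact hfac
        rw [e]; exact IsIrreducibleHom.comp_isIso hf _
      have hT₀ := extHom_irreducible_imp π X T₀ hT ht hirr'
      subst hT₀
      exact mem_singleton_iff.mpr (Quotient.sound ⟨(Under.isoMk (@asIso _ _ _ _ j (hj hs)) hfac).symm⟩)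
    · -- (P) a linear arrow over a non-isomorphism of `D`: a pull-back morphism over an irreducible of `D[ℂ]`
      refine Or.inr (Or.inr ?_)
      obtain ⟨-, hfull⟩ := full_of_irreducible π f.hom hf hs
      have hY : (π.obj f.right.snd).IsComplex := isComplex_of_full π f.hom hX hfull
      have hcY : RC.complexObjects (baseRC π) f.right.snd := (D0.complexObjects_comp_iff π _).mpr hY
      let g : Under (⟨X.snd, hc⟩ : RC.ComplexPart (baseRC π)) :=
        Under.mk (ObjectProperty.homMk f.hom.snd : (⟨X.snd, hc⟩ : RC.ComplexPart (baseRC π)) ⟶ ⟨f.right.snd, hcY⟩)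
      refine ⟨Quotient.mk _ g, ⟨g, irreducible_snd π f.hom hf hd hfull hc hcY, rfl⟩, ?_⟩
      rw [hG g]
      exact Quotient.sound (under_iso_push π f.hom hd hfull hY)
  · -- (F) an arrow of degree `d ≠ 1`: the Frobenius-type arrow of degree `d`, with `d` bounded
    refine Or.inl ?_
    obtain ⟨φ', hfac, -, -, -⟩ := fac_pow π f.hom
    rcases hf.2 _ _ hfac with hi | hi
    · haveI := hi
      have hirr' : IsIrreducibleHom (powHom π X (C0.degFr f.hom.fst)) := by
        have e : powHom π X (C0.degFr f.hom.fst) = f.hom ≫ inv φ' := by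
          rw [← cancel_mono φ', Category.assoc, IsIso.inv_hom_id, Category.comp_id]; exact hfac
        rw [e]; exact IsIrreducibleHom.comp_isIso hf _
      refine ⟨(C0.degFr f.hom.fst).natPred, natPred_lt_of_irreducible_powHom π X hX hN _ hirr', ?_⟩
      change Quotient.mk _ (Under.mk (powHom π X (C0.degFr f.hom.fst).natPred.succPNat)) = Quotient.mk _ f
      rw [PNat.succPNat_natPred]
      exact Quotient.sound ⟨Under.isoMk (@asIso _ _ _ _ φ' hi) hfac⟩
    · haveI := hi
      exact absurd (eq_one_of_isIso_powHom π X _) hd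

end NonIso

end ArchFrd

end

end Literature.AlgebraicGeometry.Frobenioids
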